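import Mathlib
import Literature.Probability.LatticeModels.LatticeGraph

/-!
# Route `SmallBetaInfraredSplit` (sub QCD) — item `ZeroCountChessboard` (stmt-QuantumFields-23819), part 1:
# the Fröhlich–Simon–Spencer zero-count maximiser principle and the reflection bookkeeping

(A) Abstract form of the "chessboard by zero count" step in the proof of Gaussian domination
(Fröhlich–Simon–Spencer 1976, proof of Thm. 2.1; Salmhofer–Seiler 1991 (3.91)–(3.95)): a continuous
function `F ≥ 0` on a finite-dimensional real coordinate space that tends to `0` at infinity and admits,
at every point with a non-zero coordinate, a "reflection pair" `g₁, g₂` with `F(g)² ≤ F(g₁)F(g₂)` whose total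
number of vanishing coordinates exceeds twice that of `g` by at least two, is maximised at the origin.  (B) For the concrete twist `h ↦ h₊, h₋` of the route's
`TwistedReflectionBound` (reflection `θ: x_μ ↦ 2c+1−x_μ` in a plane bisecting the `μ`-bonds `(c, c+1)`, even
torus): `h_{±}` vanishes on the crossing bonds and copies `h` resp. its mirror image elsewhere, so
`z(h₊) + z(h₋) ≥ 2 z(h) + 2` as soon as `h` is non-zero on one crossing bond (`two_mul_zeroCount_add_two_le`).
Part 2 (`…ZeroCountChessboard.lean`) supplies continuity/decay of `Z[h]` and closes the item.  Support lemmas only;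
nothing about `QCD`, `YangMills`, a mass gap or a continuum limit is proved here.
[cite: FrohlichSimonSpencer1976, proof of Thm. 2.1; SalmhoferSeiler1991, (3.84)–(3.95)]
-/

set_option autoImplicit false

namespace Summit.QuantumFields.QCD.Theorems.SmallBetaInfraredSplit.ZeroCount

open Finset Filter Topology
open Literature.Probability.LatticeModels (TorusSite)

section ArgMax

variable {ι : Type*} [Fintype ι]

/-- The number of vanishing coordinates of `g`. [cite: FrohlichSimonSpencer1976, proof of Thm. 2.1] -/
noncomputable def zeroCount (g : ι → ℝ) : ℕ := (univ.filter fun b => g b = 0).card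

/-- At most all coordinates vanish. [cite: FrohlichSimonSpencer1976, proof of Thm. 2.1] -/
theorem zeroCount_le (g : ι → ℝ) : zeroCount g ≤ Fintype.card ι :=
  (card_filter_le _ _).trans (by rw [card_univ])

/-- If all coordinates vanish the point is the origin. [cite: FrohlichSimonSpencer1976, proof of Thm. 2.1] -/
theorem eq_zero_of_zeroCount_eq (g : ι → ℝ) (h : zeroCount g = Fintype.card ι) : g = 0 := by
  have hu := Finset.eq_univ_of_card _ h
  funext b
  have hb : b ∈ univ.filter fun b => g b = 0 := by rw [hu]; exact mem_univ b
  simpa using hb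

/-- A point with fewer than all coordinates vanishing has a non-zero coordinate.
[cite: FrohlichSimonSpencer1976, proof of Thm. 2.1] -/
theorem exists_ne_zero_of_zeroCount_ne (g : ι → ℝ) (h : zeroCount g ≠ Fintype.card ι) : ∃ b, g b ≠ 0 := by
  by_contra hnone
  push Not at hnone
  apply h
  unfold zeroCount
  rw [filter_true_of_mem fun b _ => hnone b, card_univ]

/-- **The zero-count maximiser principle** (Fröhlich–Simon–Spencer): `F ≥ 0` continuous, `F → 0` at
infinity, and every point with a non-zero coordinate admits `g₁, g₂` with `F(g)² ≤ F(g₁)F(g₂)` and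
`z(g₁) + z(g₂) ≥ 2z(g) + 2` (`z` = number of zero coordinates); then `F(g) ≤ F(0)` for all `g`.  (A maximiser
exists; among maximisers take one with the most zeros; if it had a non-zero coordinate both `g₁, g₂` would be
maximisers and one of them would have more zeros.) [cite: FrohlichSimonSpencer1976, proof of Thm. 2.1] -/
theorem le_apply_zero_of_reflection (F : (ι → ℝ) → ℝ) (hF0 : ∀ g, 0 ≤ F g) (hFc : Continuous F)
    (hFt : Tendsto F (cocompact (ι → ℝ)) (𝓝 0))
    (hrefl : ∀ g : ι → ℝ, ∀ b, g b ≠ 0 → ∃ g₁ g₂ : ι → ℝ,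
      F g ^ 2 ≤ F g₁ * F g₂ ∧ 2 * zeroCount g + 2 ≤ zeroCount g₁ + zeroCount g₂) (g : ι → ℝ) :
    F g ≤ F 0 := by
  classical
  by_contra hcon
  push Not at hcon
  have hpos : 0 < F g := (hF0 0).trans_lt hcon
  -- a maximiser exists
  have hev : ∀ᶠ x in cocompact (ι → ℝ), F x ≤ F g := hFt (Iic_mem_nhds hpos)
  obtain ⟨m, hm⟩ := hFc.exists_forall_ge' g hev
  have hMpos : 0 < F m := hpos.trans_le (hm g)
  -- a maximiser with the largest number of zeros
  let P : ℕ → Prop := fun k => ∃ g' : ι → ℝ, (∀ y, F y ≤ F g') ∧ zeroCount g' = k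
  obtain ⟨g', hg'max, hg'k⟩ : P (Nat.findGreatest P (Fintype.card ι)) :=
    Nat.findGreatest_spec (P := P) (zeroCount_le m) ⟨m, hm, rfl⟩
  have hkmax : ∀ g'' : ι → ℝ, (∀ y, F y ≤ F g'') → zeroCount g'' ≤ Nat.findGreatest P (Fintype.card ι) :=
    fun g'' hg'' => Nat.le_findGreatest (zeroCount_le g'') ⟨g'', hg'', rfl⟩
  by_cases hz : zeroCount g' = Fintype.card ι
  · have h0 : g' = 0 := eq_zero_of_zeroCount_eq g' hz
    rw [h0] at hg'max
    exact absurd (hg'max g) (not_le.2 hcon)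
  · obtain ⟨b, hb⟩ := exists_ne_zero_of_zeroCount_ne g' hz
    obtain ⟨g₁, g₂, hsq, hcount⟩ := hrefl g' b hb
    have hFg' : F g' = F m := le_antisymm (hm g') (hg'max m)
    have h1 : F g₁ ≤ F m := hm g₁
    have h2 : F g₂ ≤ F m := hm g₂
    have h1' : F m ≤ F g₁ := by
      by_contra hlt
      push Not at hlt
      have : F g₁ * F g₂ < F m * F m := by nlinarith [hF0 g₁, hF0 g₂]
      nlinarith [hsq, hFg']
    have h2' : F m ≤ F g₂ := by
      by_contra hlt
      push Not at hlt
      have : F g₁ * F g₂ < F m * F m := by nlinarith [hF0 g₁, hF0 g₂]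
      nlinarith [hsq, hFg']
    have hk1 := hkmax g₁ fun y => (hm y).trans h1'
    have hk2 := hkmax g₂ fun y => (hm y).trans h2'
    omega

end ArgMax

variable {ν L : ℕ}

/-- The reflection `θ : x_μ ↦ 2c + 1 − x_μ` of `TwistedReflectionBound` (plane bisecting the links
`(c, c+1)` in direction `μ`). [cite: FrohlichSimonSpencer1976, §2; SalmhoferSeiler1991, (3.84)] -/
def refl (μ : Fin ν) (c : ZMod L) (x : TorusSite ν L) : TorusSite ν L :=
  Function.update x μ (2 * c + 1 - x μ)

/-- The half-space indicator `x_μ ∈ {c − L/2 + 1, …, c}` of `TwistedReflectionBound`.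
[cite: FrohlichSimonSpencer1976, §2; SalmhoferSeiler1991, (3.84)] -/
def inPlus (μ : Fin ν) (c : ZMod L) (x : TorusSite ν L) : Bool :=
  decide ((c - x μ).val < L / 2)

/-- The twisted reflected bond field `h_±` of `TwistedReflectionBound` (`keep = true` is `h₊`).
[cite: FrohlichSimonSpencer1976, §2; SalmhoferSeiler1991, (3.84)–(3.89)] -/
def tw (μ : Fin ν) (c : ZMod L) (h : TorusSite ν L × Fin ν → ℝ) (keep : Bool)
    (b : TorusSite ν L × Fin ν) : ℝ :=
  if b.2 ≠ μ then (if inPlus μ c b.1 = keep then h b else h (refl μ c b.1, b.2))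
  else if inPlus μ c b.1 = keep ∧ inPlus μ c (b.1 + Pi.single μ 1) = keep then h b
  else if inPlus μ c b.1 ≠ keep ∧ inPlus μ c (b.1 + Pi.single μ 1) ≠ keep then
    -h (refl μ c (b.1 + Pi.single μ 1), μ) else 0

/-- The bond map `ρ` pairing a bond with its mirror image (transverse bonds: reflect the base point;
`μ`-bonds: the reflected bond, re-based at its lower end). [cite: FrohlichSimonSpencer1976, §2] -/
def rho (μ : Fin ν) (c : ZMod L) (b : TorusSite ν L × Fin ν) : TorusSite ν L × Fin ν :=
  if b.2 = μ then (refl μ c (b.1 + Pi.single μ 1), μ) else (refl μ c b.1, b.2)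

section Facts

variable (μ : Fin ν) (c : ZMod L)

/-- `(θx)_μ = 2c + 1 − x_μ`. [cite: SalmhoferSeiler1991, (3.84)] -/
theorem refl_apply_self (x : TorusSite ν L) : refl μ c x μ = 2 * c + 1 - x μ := by simp [refl]

/-- `θ` fixes the transverse coordinates. [cite: SalmhoferSeiler1991, (3.84)] -/
theorem refl_apply_ne (x : TorusSite ν L) {j : Fin ν} (hj : j ≠ μ) : refl μ c x j = x j := by simp [refl, hj]

/-- `θ` is an involution. [cite: SalmhoferSeiler1991, (3.84)] -/
theorem refl_refl (x : TorusSite ν L) : refl μ c (refl μ c x) = x := by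
  funext j
  by_cases hj : j = μ
  · subst hj; rw [refl_apply_self, refl_apply_self]; ring
  · rw [refl_apply_ne μ c _ hj, refl_apply_ne μ c _ hj]

/-- `θ(x + e_μ) + e_μ = θx`: `θ` maps the bond `(x, x+e_μ)` onto the bond `(θ(x+e_μ), θx)`.
[cite: SalmhoferSeiler1991, (3.84)] -/
theorem refl_add_single_add_single (x : TorusSite ν L) :
    refl μ c (x + Pi.single μ 1) + Pi.single μ 1 = refl μ c x := by
  funext j
  by_cases hj : j = μ
  · subst hj
    rw [Pi.add_apply, refl_apply_self, refl_apply_self, Pi.add_apply, Pi.single_eq_same]; ring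
  · rw [Pi.add_apply, refl_apply_ne μ c _ hj, refl_apply_ne μ c _ hj, Pi.add_apply,
      Pi.single_eq_of_ne hj, add_zero, add_zero]

/-- On an even torus the reflection swaps the two half spaces. [cite: SalmhoferSeiler1991, (3.84)] -/
theorem inPlus_refl [NeZero L] (hL : Even L) (x : TorusSite ν L) : inPlus μ c (refl μ c x) = !inPlus μ c x := by
  obtain ⟨m, hm⟩ := hL
  have hL0 : 0 < L := Nat.pos_of_ne_zero (NeZero.ne L)
  unfold inPlus
  rw [refl_apply_self]
  set t : ZMod L := c - x μ with ht
  have hrew : c - (2 * c + 1 - x μ) = -t - 1 := by rw [ht]; ring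
  rw [hrew]
  have hsum : (-t - 1 + t : ZMod L) = -1 := by ring
  have hv1 : ((-1 : ZMod L)).val = L - 1 := by
    obtain ⟨k, hk⟩ : ∃ k, L = k + 1 := ⟨L - 1, by omega⟩
    subst hk
    rw [ZMod.val_neg_one]; rfl
  have hval : ((-t - 1 + t : ZMod L)).val = ((-t - 1 : ZMod L).val + t.val) % L := ZMod.val_add _ _
  rw [hsum, hv1] at hval
  have ha := ZMod.val_lt (-t - 1 : ZMod L)
  have hb := ZMod.val_lt t
  have hkey : (-t - 1 : ZMod L).val + t.val = L - 1 := by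
    rcases Nat.lt_or_ge ((-t - 1 : ZMod L).val + t.val) L with h | h
    · rw [Nat.mod_eq_of_lt h] at hval; exact hval.symm
    · have h2 : ((-t - 1 : ZMod L).val + t.val) % L = (-t - 1 : ZMod L).val + t.val - L := by
        rw [Nat.mod_eq_sub_mod h, Nat.mod_eq_of_lt (by omega)]
      omega
  by_cases hlt : t.val < L / 2
  · simp only [hlt, decide_true, Bool.not_true, decide_eq_false_iff_not, not_lt]; omega
  · simp only [hlt, decide_false, Bool.not_false, decide_eq_true_eq]; omega

/-- The bond mirror map is an involution. [cite: FrohlichSimonSpencer1976, §2] -/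
theorem rho_rho (b : TorusSite ν L × Fin ν) : rho μ c (rho μ c b) = b := by
  obtain ⟨x, j⟩ := b
  unfold rho
  by_cases hj : j = μ
  · subst hj
    simp only [if_true]
    rw [refl_add_single_add_single, refl_refl]
  · simp only [hj, if_false]
    rw [refl_refl]

/-- … hence injective. [cite: FrohlichSimonSpencer1976, §2] -/
theorem rho_injective : Function.Injective (rho μ c) :=
  Function.LeftInverse.injective (rho_rho μ c)

end Facts

section Count

variable [NeZero L] (μ : Fin ν) (c : ZMod L)

/-- The bonds on which `h_{keep}` copies `h`: transverse bonds based in the `keep` half and `μ`-bonds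
with both endpoints there. [cite: FrohlichSimonSpencer1976, §2] -/
def keepSet (keep : Bool) : Finset (TorusSite ν L × Fin ν) :=
  univ.filter fun b => (b.2 ≠ μ ∧ inPlus μ c b.1 = keep) ∨
    (b.2 = μ ∧ inPlus μ c b.1 = keep ∧ inPlus μ c (b.1 + Pi.single μ 1) = keep)

/-- The bonds crossing the reflection plane (or its antipode). [cite: FrohlichSimonSpencer1976, §2] -/
def crossSet : Finset (TorusSite ν L × Fin ν) :=
  univ.filter fun b => b.2 = μ ∧ inPlus μ c b.1 ≠ inPlus μ c (b.1 + Pi.single μ 1)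

variable {μ c}

/-- Membership in the kept region. [cite: FrohlichSimonSpencer1976, §2] -/
theorem mem_keepSet_iff (keep : Bool) (b : TorusSite ν L × Fin ν) :
    b ∈ keepSet μ c keep ↔ (b.2 ≠ μ ∧ inPlus μ c b.1 = keep) ∨
      (b.2 = μ ∧ inPlus μ c b.1 = keep ∧ inPlus μ c (b.1 + Pi.single μ 1) = keep) := by
  simp only [keepSet, mem_filter, mem_univ, true_and]

/-- Membership in the crossing set. [cite: FrohlichSimonSpencer1976, §2] -/
theorem mem_crossSet_iff (b : TorusSite ν L × Fin ν) :
    b ∈ crossSet μ c ↔ b.2 = μ ∧ inPlus μ c b.1 ≠ inPlus μ c (b.1 + Pi.single μ 1) := by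
  simp only [crossSet, mem_filter, mem_univ, true_and]

/-- `h_{keep} = h` on the kept region. [cite: FrohlichSimonSpencer1976, §2] -/
theorem tw_of_mem_keepSet (h : TorusSite ν L × Fin ν → ℝ) (keep : Bool) {b : TorusSite ν L × Fin ν}
    (hb : b ∈ keepSet μ c keep) : tw μ c h keep b = h b := by
  rw [mem_keepSet_iff] at hb
  unfold tw
  rcases hb with ⟨hμ, h1⟩ | ⟨hμ, h1, h2⟩
  · rw [if_pos hμ, if_pos h1]
  · rw [if_neg (not_not.2 hμ), if_pos ⟨h1, h2⟩]

/-- `h_{keep} = 0` on the crossing bonds. [cite: FrohlichSimonSpencer1976, §2] -/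
theorem tw_of_mem_crossSet (h : TorusSite ν L × Fin ν → ℝ) (keep : Bool) {b : TorusSite ν L × Fin ν}
    (hb : b ∈ crossSet μ c) : tw μ c h keep b = 0 := by
  rw [mem_crossSet_iff] at hb
  obtain ⟨hμ, hne⟩ := hb
  unfold tw
  rw [if_neg (not_not.2 hμ), if_neg, if_neg]
  · rintro ⟨h1, h2⟩
    apply hne
    cases keep <;> simp_all
  · rintro ⟨h1, h2⟩
    exact hne (h1.trans h2.symm)

/-- On the mirror region `h_{keep}` is `±` the mirrored value, so it vanishes where the mirrored bond does.
[cite: FrohlichSimonSpencer1976, §2] -/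
theorem tw_eq_zero_of_mem_keepSet_not (h : TorusSite ν L × Fin ν → ℝ) (keep : Bool)
    {b : TorusSite ν L × Fin ν} (hb : b ∈ keepSet μ c (!keep)) (h0 : h (rho μ c b) = 0) :
    tw μ c h keep b = 0 := by
  rw [mem_keepSet_iff] at hb
  unfold tw
  unfold rho at h0
  rcases hb with ⟨hμ, h1⟩ | ⟨hμ, h1, h2⟩
  · rw [if_pos hμ, if_neg (by rw [h1]; cases keep <;> simp)]
    rwa [if_neg hμ] at h0
  · rw [if_neg (not_not.2 hμ), if_neg (by rw [h1]; cases keep <;> simp),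
      if_pos ⟨by rw [h1]; cases keep <;> simp, by rw [h2]; cases keep <;> simp⟩]
    rw [if_pos hμ] at h0
    rw [h0, neg_zero]

/-- The mirror map sends the kept region into the mirror region (even torus). [cite: FrohlichSimonSpencer1976, §2] -/
theorem rho_mem_keepSet_not (hL : Even L) (keep : Bool) {b : TorusSite ν L × Fin ν}
    (hb : b ∈ keepSet μ c keep) : rho μ c b ∈ keepSet μ c (!keep) := by
  rw [mem_keepSet_iff] at hb ⊢
  unfold rho
  rcases hb with ⟨hμ, h1⟩ | ⟨hμ, h1, h2⟩
  · rw [if_neg hμ]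
    exact Or.inl ⟨hμ, by rw [inPlus_refl μ c hL, h1]⟩
  · rw [if_pos hμ]
    refine Or.inr ⟨rfl, ?_, ?_⟩
    · rw [inPlus_refl μ c hL, h2]
    · rw [refl_add_single_add_single, inPlus_refl μ c hL, h1]

/-- The two kept regions are disjoint. [cite: FrohlichSimonSpencer1976, §2] -/
theorem disjoint_keepSet : Disjoint (keepSet μ c true) (keepSet μ c false) := by
  refine Finset.disjoint_left.2 fun b hb1 hb2 => ?_
  rw [mem_keepSet_iff] at hb1 hb2
  rcases hb1 with ⟨hμ, h1⟩ | ⟨hμ, h1, -⟩ <;> rcases hb2 with ⟨hμ', h1'⟩ | ⟨hμ', h1', -⟩ <;> simp_all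

/-- A kept region and its mirror region are disjoint. [cite: FrohlichSimonSpencer1976, §2] -/
theorem disjoint_keepSet_not (keep : Bool) : Disjoint (keepSet μ c keep) (keepSet μ c (!keep)) := by
  cases keep; exacts [disjoint_keepSet.symm, disjoint_keepSet]

/-- Kept regions avoid the crossing bonds. [cite: FrohlichSimonSpencer1976, §2] -/
theorem disjoint_keepSet_crossSet (keep : Bool) : Disjoint (keepSet μ c keep) (crossSet μ c) := by
  refine Finset.disjoint_left.2 fun b hb1 hb2 => ?_
  rw [mem_keepSet_iff] at hb1
  rw [mem_crossSet_iff] at hb2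
  rcases hb1 with ⟨hμ, -⟩ | ⟨-, h1, h2⟩
  · exact hμ hb2.1
  · exact hb2.2 (h1.trans h2.symm)

/-- Every bond is kept by `h₊`, kept by `h₋`, or crossing. [cite: FrohlichSimonSpencer1976, §2] -/
theorem mem_cover (b : TorusSite ν L × Fin ν) :
    b ∈ keepSet μ c true ∨ b ∈ keepSet μ c false ∨ b ∈ crossSet μ c := by
  rw [mem_keepSet_iff, mem_keepSet_iff, mem_crossSet_iff]
  by_cases hμ : b.2 = μ
  · by_cases heq : inPlus μ c b.1 = inPlus μ c (b.1 + Pi.single μ 1)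
    · cases hv : inPlus μ c b.1
      · exact Or.inr (Or.inl (Or.inr ⟨hμ, rfl, by rw [← heq, hv]⟩))
      · exact Or.inl (Or.inr ⟨hμ, rfl, by rw [← heq, hv]⟩)
    · exact Or.inr (Or.inr ⟨hμ, heq⟩)
  · cases hv : inPlus μ c b.1
    · exact Or.inr (Or.inl (Or.inl ⟨hμ, rfl⟩))
    · exact Or.inl (Or.inl ⟨hμ, rfl⟩)

/-- The zero count of `h_{keep}`: at least twice the zeros of `h` in the kept region plus all crossing
bonds. [cite: FrohlichSimonSpencer1976, proof of Thm. 2.1] -/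
theorem zeroCount_tw_ge (hL : Even L) (h : TorusSite ν L × Fin ν → ℝ) (keep : Bool) :
    2 * ((keepSet μ c keep).filter fun b => h b = 0).card + (crossSet μ c).card ≤
      zeroCount (tw μ c h keep) := by
  classical
  set A := (keepSet μ c keep).filter fun b => h b = 0 with hA
  have hAsub : A ⊆ keepSet μ c keep := filter_subset _ _
  have hIsub : A.image (rho μ c) ⊆ keepSet μ c (!keep) := by
    intro b hb
    obtain ⟨b', hb', rfl⟩ := mem_image.1 hb
    exact rho_mem_keepSet_not hL keep (hAsub hb')
  have hd1 : Disjoint A (A.image (rho μ c)) :=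
    Finset.disjoint_of_subset_left hAsub (Finset.disjoint_of_subset_right hIsub (disjoint_keepSet_not keep))
  have hd2 : Disjoint (A ∪ A.image (rho μ c)) (crossSet μ c) := by
    rw [Finset.disjoint_union_left]
    exact ⟨Finset.disjoint_of_subset_left hAsub (disjoint_keepSet_crossSet keep),
      Finset.disjoint_of_subset_left hIsub (disjoint_keepSet_crossSet (!keep))⟩
  have hsub : A ∪ A.image (rho μ c) ∪ crossSet μ c ⊆ univ.filter fun b => tw μ c h keep b = 0 := by
    intro b hb
    rw [mem_filter]
    refine ⟨mem_univ _, ?_⟩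
    rcases mem_union.1 hb with hb | hb
    · rcases mem_union.1 hb with hb | hb
      · obtain ⟨hbK, hb0⟩ := mem_filter.1 hb
        rw [tw_of_mem_keepSet h keep hbK, hb0]
      · obtain ⟨b', hb', rfl⟩ := mem_image.1 hb
        obtain ⟨hbK, hb0⟩ := mem_filter.1 hb'
        exact tw_eq_zero_of_mem_keepSet_not h keep (rho_mem_keepSet_not hL keep hbK)
          (by rw [rho_rho]; exact hb0)
    · exact tw_of_mem_crossSet h keep hb
  have hcard := card_le_card hsub
  rw [card_union_of_disjoint hd2, card_union_of_disjoint hd1,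
    card_image_of_injective _ (rho_injective μ c)] at hcard
  unfold zeroCount
  omega

/-- The zero count of `h` split along the partition kept/kept/crossing. [cite: FrohlichSimonSpencer1976, proof of Thm. 2.1] -/
theorem zeroCount_eq_sum (h : TorusSite ν L × Fin ν → ℝ) :
    zeroCount h = ((keepSet μ c true).filter fun b => h b = 0).card +
      ((keepSet μ c false).filter fun b => h b = 0).card + ((crossSet μ c).filter fun b => h b = 0).card := by
  classical
  have hunion : (univ.filter fun b => h b = 0) = ((keepSet μ c true).filter fun b => h b = 0) ∪
      ((keepSet μ c false).filter fun b => h b = 0) ∪ ((crossSet μ c).filter fun b => h b = 0) := by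
    ext b
    simp only [mem_union, mem_filter, mem_univ, true_and]
    constructor
    · intro hb
      rcases mem_cover (μ := μ) (c := c) b with h1 | h1 | h1
      · exact Or.inl (Or.inl ⟨h1, hb⟩)
      · exact Or.inl (Or.inr ⟨h1, hb⟩)
      · exact Or.inr ⟨h1, hb⟩
    · rintro ((⟨-, hb⟩ | ⟨-, hb⟩) | ⟨-, hb⟩) <;> exact hb
  have hd1 : Disjoint ((keepSet μ c true).filter fun b => h b = 0)
      ((keepSet μ c false).filter fun b => h b = 0) :=
    Finset.disjoint_of_subset_left (filter_subset _ _)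
      (Finset.disjoint_of_subset_right (filter_subset _ _) disjoint_keepSet)
  have hd2 : Disjoint (((keepSet μ c true).filter fun b => h b = 0) ∪
      ((keepSet μ c false).filter fun b => h b = 0)) ((crossSet μ c).filter fun b => h b = 0) := by
    rw [Finset.disjoint_union_left]
    exact ⟨Finset.disjoint_of_subset_left (filter_subset _ _)
        (Finset.disjoint_of_subset_right (filter_subset _ _) (disjoint_keepSet_crossSet true)),
      Finset.disjoint_of_subset_left (filter_subset _ _)
        (Finset.disjoint_of_subset_right (filter_subset _ _) (disjoint_keepSet_crossSet false))⟩
  unfold zeroCount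
  rw [hunion, card_union_of_disjoint hd2, card_union_of_disjoint hd1]

/-- **One of `h₊, h₋` has more zeros**: if `h` does not vanish on some crossing bond then
`z(h₊) + z(h₋) ≥ 2 z(h) + 2`. [cite: FrohlichSimonSpencer1976, proof of Thm. 2.1] -/
theorem two_mul_zeroCount_add_two_le (hL : Even L) (h : TorusSite ν L × Fin ν → ℝ)
    {b₀ : TorusSite ν L × Fin ν} (hb₀ : b₀ ∈ crossSet μ c) (hne : h b₀ ≠ 0) :
    2 * zeroCount h + 2 ≤ zeroCount (tw μ c h true) + zeroCount (tw μ c h false) := by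
  classical
  have ht := zeroCount_tw_ge (μ := μ) (c := c) hL h true
  have hf := zeroCount_tw_ge (μ := μ) (c := c) hL h false
  have hz := zeroCount_eq_sum (μ := μ) (c := c) h
  have hC : ((crossSet μ c).filter fun b => h b = 0).card < (crossSet μ c).card :=
    card_lt_card (filter_ssubset.2 ⟨b₀, hb₀, hne⟩)
  omega

end Count

end Summit.QuantumFields.QCD.Theorems.SmallBetaInfraredSplit.ZeroCount
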